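import Mathlib
import Summits.ValiantsHypothesis.ValiantsHypothesis.Theorems.LacunarySymmetroidMatrixDescartesInertiaOneType

/-!
# `MatrixDescartes` (stmt-ValiantsHypothesis-18050) — INERTIA KIT, IV-h: THE FIRST-ROOT LAW — if every positive root `t` of `det F`
# is the FIRST positive root of the Rayleigh `K`-nomial of each of its kernel vectors (the `K`-nomial is positive on `(0, t)` and `t` is
# a simple root of it), then `Z₊ ≤ m` with multiplicity; mirror LAST-ROOT LAW; every symmetric lacunary pencil, every format

HONEST FRAMING.  Cell `pub-symmetroid`, seat `val-sym-mdr-p2` (gen 17); helper file `--supports` the crux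
`Theses.LacunarySymmetroid.MatrixDescartes`, NO closure claim.  A format-free family in Rayleigh-quotient language, strictly larger
than g16's intrinsic one-crossing sector (`…DefiniteMomentsOneCrossing`: `S₀ ≻ 0` and every Rayleigh `K`-nomial with AT MOST ONE
positive root — here later roots of the `K`-nomials are allowed, only the kernel vectors at each root must see it as their first root),
obtained as an instance of the ONE-TYPE LAW (`…InertiaOneType`).  Nothing here bears on the crux in its window, on `stub_twoSided`, on
`DoorA26`/`DoorA34`, registers, or `VP ≠ VNP`.

CONTENT.  §1 scalar: `derivative_neg_of_pos_before` — a real polynomial positive on `(a, t)` with a SIMPLE root at `t` has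
`f′(t) < 0` (factor `f = (X − t)·q`, `q(t) = f′(t)`, continuity of `q`; no limits); `derivative_pos_of_pos_after` — mirror.  §2 THE
FIRST-ROOT LAW `card_posRoots_multiset_le_of_firstRoot`: if at every positive root `t` of `det F` every non-zero kernel vector `u` has
`P_u > 0` on `(0, t)` and `P_u′(t) ≠ 0` (`P_u = ∑ₖ (uᵀSₖu)X^{dₖ}`), then every positive root is of negative type and the positive roots
counted with multiplicity number at most `card ι`; THE LAST-ROOT LAW `card_posRoots_multiset_le_of_lastRoot`: `P_u > 0` on `(t, ∞)`
and `P_u′(t) ≠ 0` ⇒ positive type ⇒ the same bound.  READING: a REVIVAL (positive-type root) needs a kernel vector whose Rayleigh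
`K`-nomial has already vanished before `t` — at least two sign changes in its coefficient sequence `(uᵀSₖu)ₖ` with `t` not the first
root. [folklore]; axioms standard; no definitions.
-/

-- layout Summits/ValiantsHypothesis/ValiantsHypothesis forces the duplicated namespace component
set_option linter.dupNamespace false

namespace Summit.ValiantsHypothesis.ValiantsHypothesis.Theorems.LacunarySymmetroidMatrixDescartes

open Matrix Finset Polynomial
open scoped BigOperators Topology

namespace Inertia

/-! ## §1 Sign of the derivative at a first / last simple root -/

/-- **A polynomial positive just before a simple root decreases through it.**  `f(t) = 0`, `f′(t) ≠ 0`, and `f > 0` on `(a, t)` for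
some `a < t` ⇒ `f′(t) < 0`. [folklore] -/
theorem derivative_neg_of_pos_before (f : ℝ[X]) {a t : ℝ} (hat : a < t) (hroot : f.eval t = 0)
    (hsimple : (derivative f).eval t ≠ 0) (hpos : ∀ x, a < x → x < t → 0 < f.eval x) :
    (derivative f).eval t < 0 := by
  rcases lt_or_gt_of_ne hsimple with h | h
  · exact h
  exfalso
  -- factor `f = (X − t)·q` with `q(t) = f′(t) > 0`
  have hf : (X - C t) * (f /ₘ (X - C t)) = f := mul_divByMonic_eq_iff_isRoot.2 hroot
  set q := f /ₘ (X - C t) with hq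
  have hqt : q.eval t = (derivative f).eval t := Multiplicity.eval_divByMonic_eq_eval_derivative hroot
  have hqpos : 0 < q.eval t := by rw [hqt]; exact h
  -- `q > 0` near `t`, so `f < 0` just left of `t`
  have hcont : Continuous fun x => q.eval x := q.continuous
  have hev : ∀ᶠ x in 𝓝 t, 0 < q.eval x := (continuousAt_const.eventually_lt hcont.continuousAt hqpos)
  obtain ⟨ε, hε, hεq⟩ := Metric.eventually_nhds_iff.1 hev
  obtain ⟨x, hx, hxd⟩ := exists_mem_Ioo_near_right hat hε
  have hqx : 0 < q.eval x := hεq hxd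
  have hfx : f.eval x = (x - t) * q.eval x := by
    rw [← hf, eval_mul, eval_sub, eval_X, eval_C]
  have hneg : f.eval x < 0 := by
    rw [hfx]
    exact mul_neg_of_neg_of_pos (by linarith [hx.2]) hqx
  exact absurd (hpos x hx.1 hx.2) (not_lt.2 hneg.le)

/-- **A polynomial positive just after a simple root increases through it.**  `f(t) = 0`, `f′(t) ≠ 0`, and `f > 0` on `(t, b)` for
some `b > t` ⇒ `0 < f′(t)`. [folklore] -/
theorem derivative_pos_of_pos_after (f : ℝ[X]) {t b : ℝ} (htb : t < b) (hroot : f.eval t = 0)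
    (hsimple : (derivative f).eval t ≠ 0) (hpos : ∀ x, t < x → x < b → 0 < f.eval x) :
    0 < (derivative f).eval t := by
  rcases lt_or_gt_of_ne hsimple with h | h
  swap
  · exact h
  exfalso
  have hf : (X - C t) * (f /ₘ (X - C t)) = f := mul_divByMonic_eq_iff_isRoot.2 hroot
  set q := f /ₘ (X - C t) with hq
  have hqt : q.eval t = (derivative f).eval t := Multiplicity.eval_divByMonic_eq_eval_derivative hroot
  have hqneg : q.eval t < 0 := by rw [hqt]; exact h
  have hcont : Continuous fun x => q.eval x := q.continuous
  have hev : ∀ᶠ x in 𝓝 t, q.eval x < 0 := hcont.continuousAt.eventually_lt continuousAt_const hqneg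
  obtain ⟨ε, hε, hεq⟩ := Metric.eventually_nhds_iff.1 hev
  obtain ⟨x, hx, hxd⟩ := exists_mem_Ioo_near_left htb hε
  have hqx : q.eval x < 0 := hεq hxd
  have hfx : f.eval x = (x - t) * q.eval x := by
    rw [← hf, eval_mul, eval_sub, eval_X, eval_C]
  have hneg : f.eval x < 0 := by
    rw [hfx]
    exact mul_neg_of_pos_of_neg (by linarith [hx.1]) hqx
  exact absurd (hpos x hx.1 hx.2) (not_lt.2 hneg.le)

/-! ## §2 The first-root and last-root laws -/

section Pencil

variable {ι κ : Type} [Fintype ι] [DecidableEq ι] [Fintype κ]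

/-- **THE FIRST-ROOT LAW.**  `F(X) = ∑ₖ X^{dₖ}Sₖ` real symmetric.  If at every positive root `t` of `det F` every non-zero kernel vector
`u` of `F(t)` has Rayleigh `K`-nomial `P_u = ∑ₖ (uᵀSₖu)X^{dₖ}` POSITIVE on `(0, t)` with `P_u′(t) ≠ 0` (so `t` is the first positive root
of `P_u`, and simple), then every positive root is of negative type and the positive roots of `det F` counted with multiplicity number at
most `card ι`. [folklore] -/
theorem card_posRoots_multiset_le_of_firstRoot (d : κ → ℕ) (S : κ → Matrix ι ι ℝ) (hS : ∀ k, (S k).IsSymm)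
    (hfirst : ∀ t, 0 < t → (∑ k, t ^ d k • S k).det = 0 → ∀ u : ι → ℝ, (∑ k, t ^ d k • S k) *ᵥ u = 0 → u ≠ 0 →
      (∀ x, 0 < x → x < t → 0 < (∑ k, C (u ⬝ᵥ (S k *ᵥ u)) * (X : ℝ[X]) ^ d k).eval x) ∧
      (derivative (∑ k, C (u ⬝ᵥ (S k *ᵥ u)) * (X : ℝ[X]) ^ d k)).eval t ≠ 0) :
    Multiset.card ((Matrix.det (∑ k, ((X : ℝ[X]) ^ d k) • (S k).map C)).roots.filter (fun t => 0 < t))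
      ≤ Fintype.card ι := by
  refine card_posRoots_multiset_le_of_negType d S hS fun t ht hdt u hu hu0 => ?_
  obtain ⟨hpos, hsimple⟩ := hfirst t ht hdt u hu hu0
  -- the Rayleigh `K`-nomial vanishes at the root: `P_u(t) = uᵀF(t)u = 0`
  have hroot : (∑ k, C (u ⬝ᵥ (S k *ᵥ u)) * (X : ℝ[X]) ^ d k).eval t = 0 := by
    have h : u ⬝ᵥ ((∑ k, t ^ d k • S k) *ᵥ u) = 0 := by rw [hu, dotProduct_zero]
    rw [DefiniteMoments.form_eq_sum] at h
    rw [eval_finsetSum]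
    rw [← h]
    refine Finset.sum_congr rfl fun k _ => ?_
    rw [eval_mul, eval_C, eval_pow, eval_X, mul_comm]
  exact derivative_neg_of_pos_before _ ht hroot hsimple hpos

/-- **THE LAST-ROOT LAW.**  If at every positive root `t` of `det F` every non-zero kernel vector `u` has `P_u` POSITIVE on `(t, ∞)`
with `P_u′(t) ≠ 0` (so `t` is the last positive root of `P_u`, and simple), then every positive root is of positive type and the positive
roots counted with multiplicity number at most `card ι`. [folklore] -/
theorem card_posRoots_multiset_le_of_lastRoot (d : κ → ℕ) (S : κ → Matrix ι ι ℝ) (hS : ∀ k, (S k).IsSymm)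
    (hlast : ∀ t, 0 < t → (∑ k, t ^ d k • S k).det = 0 → ∀ u : ι → ℝ, (∑ k, t ^ d k • S k) *ᵥ u = 0 → u ≠ 0 →
      (∀ x, t < x → 0 < (∑ k, C (u ⬝ᵥ (S k *ᵥ u)) * (X : ℝ[X]) ^ d k).eval x) ∧
      (derivative (∑ k, C (u ⬝ᵥ (S k *ᵥ u)) * (X : ℝ[X]) ^ d k)).eval t ≠ 0) :
    Multiset.card ((Matrix.det (∑ k, ((X : ℝ[X]) ^ d k) • (S k).map C)).roots.filter (fun t => 0 < t))
      ≤ Fintype.card ι := by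
  refine card_posRoots_multiset_le_of_posType d S hS fun t ht hdt u hu hu0 => ?_
  obtain ⟨hpos, hsimple⟩ := hlast t ht hdt u hu hu0
  have hroot : (∑ k, C (u ⬝ᵥ (S k *ᵥ u)) * (X : ℝ[X]) ^ d k).eval t = 0 := by
    have h : u ⬝ᵥ ((∑ k, t ^ d k • S k) *ᵥ u) = 0 := by rw [hu, dotProduct_zero]
    rw [DefiniteMoments.form_eq_sum] at h
    rw [eval_finsetSum]
    rw [← h]
    refine Finset.sum_congr rfl fun k _ => ?_
    rw [eval_mul, eval_C, eval_pow, eval_X, mul_comm]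
  exact derivative_pos_of_pos_after _ (lt_add_one t) hroot hsimple fun x hx _ => hpos x hx

end Pencil

end Inertia

end Summit.ValiantsHypothesis.ValiantsHypothesis.Theorems.LacunarySymmetroidMatrixDescartes
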